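import Summits.Ventures.PercRepro.ExploreTree
import Summits.Ventures.PercRepro.GZ24Final

/-!
# Chained explorations: explore a cluster, then continue

`MultiGraph.exploreThen G toS U K cont` explores the cluster of the known set `K` through the
unqueried edges `U` exactly like `explore`, sending every queried edge to `S` iff `toS`, and at
the end continues with the tree `cont U'` on the remaining unqueried edges `U'` (Gladkov–Zimin's
trees `S₁`, `S₂` of arXiv:2404.08873 §4 are chains of three explorations with alternating
decisions).  `explore = exploreThen true · · (fun _ => leaf)` (`explore_eq_exploreThen`), and a
chain continues its own all-`S` prefix (`continues_exploreThen`).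

The run of a chain is computed by `run_exploreThen`: the edges queried by an exploration stage
are exactly the unqueried edges at the final known set, and on the cylinder of the revealed
states the final known set is the cluster of `K` in the graph of unqueried edges
(`exploreThen_invariant`).

Part A of `ExploreChain` (split for the ≤ 400-line lint; proofs byte-identical) — the last part `ExploreChain.lean` imports it.
-/

namespace PercRepro

namespace MultiGraph

open Finset

variable {V E : Type*} [DecidableEq V] [DecidableEq E] (G : MultiGraph V E)

/-- Explore the cluster of `K` through the unqueried edges `U`, sending every queried edge to `S`
iff `toS`; at the end continue with `cont` applied to the remaining unqueried edges. -/
noncomputable def exploreThen (toS : Bool) : Finset E → Finset V → (Finset E → DTree E) → DTree E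
  | U, K, cont =>
    if h : (G.frontier U K).Nonempty then
      DTree.node h.choose toS fun b _ =>
        exploreThen toS (U.erase h.choose) (if b then G.addEnds K h.choose else K) cont
    else cont U
termination_by U _ _ => U.card
decreasing_by
  all_goals
    exact Finset.card_erase_lt_of_mem (Finset.mem_of_mem_filter _ h.choose_spec)

variable {G}

/-- `explore` is the chain with the trivial continuation. -/
theorem explore_eq_exploreThen : ∀ (U : Finset E) (K : Finset V),
    G.explore U K = G.exploreThen true U K (fun _ => DTree.leaf) := by
  intro U
  induction U using Finset.strongInduction with
  | H U ih =>
    intro K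
    rw [explore, exploreThen]
    split_ifs with h
    · congr 1
      funext b b'
      exact ih _ (Finset.erase_ssubset (mem_frontier.mp h.choose_spec).1) _
    · rfl

/-- A chain continues the same exploration with the trivial continuation. -/
theorem continues_exploreThen (toS : Bool) (cont : Finset E → DTree E) :
    ∀ (U : Finset E) (K : Finset V),
      DTree.Continues (G.exploreThen toS U K fun _ => DTree.leaf) (G.exploreThen toS U K cont) := by
  intro U
  induction U using Finset.strongInduction with
  | H U ih =>
    intro K
    rw [exploreThen, exploreThen]
    split_ifs with h
    · exact ⟨rfl, rfl, fun b _ => ih _ (Finset.erase_ssubset (mem_frontier.mp h.choose_spec).1) _⟩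
    · trivial

variable (G)

/-- The outcome of an exploration stage on the first configuration `ω`: the remaining
unqueried edges and the final known set. -/
noncomputable def exploreResult : Finset E → Finset V → Config E → Finset E × Finset V
  | U, K, ω =>
    if h : (G.frontier U K).Nonempty then
      exploreResult (U.erase h.choose) (if ω h.choose then G.addEnds K h.choose else K) ω
    else (U, K)
termination_by U _ _ => U.card
decreasing_by
  all_goals
    exact Finset.card_erase_lt_of_mem (Finset.mem_of_mem_filter _ h.choose_spec)

variable {G}

/-- The remaining unqueried edges of a stage are unqueried edges of the stage. -/
theorem exploreResult_fst_subset (ω : Config E) : ∀ (U : Finset E) (K : Finset V),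
    (G.exploreResult U K ω).1 ⊆ U := by
  intro U
  induction U using Finset.strongInduction with
  | H U ih =>
    intro K
    by_cases h : (G.frontier U K).Nonempty
    · rw [exploreResult, dif_pos h]
      exact (ih _ (Finset.erase_ssubset (mem_frontier.mp h.choose_spec).1) _).trans
        (Finset.erase_subset _ _)
    · rw [exploreResult, dif_neg h]

/-- **The run of a chain**: the edges queried by the stage (`U` minus the remaining unqueried
edges) go to `S` iff `toS`, and the continuation runs on the remaining edges. -/
theorem run_exploreThen (toS : Bool) (cont : Finset E → DTree E) (ω ω' : Config E) :
    ∀ (U : Finset E) (K : Finset V),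
      DTree.run (G.exploreThen toS U K cont) ω ω' =
        (if toS then (↑(U \ (G.exploreResult U K ω).1) : Set E) else ∅) ∪
          DTree.run (cont (G.exploreResult U K ω).1) ω ω' := by
  intro U
  induction U using Finset.strongInduction with
  | H U ih =>
    intro K
    by_cases h : (G.frontier U K).Nonempty
    · rw [exploreThen, dif_pos h, exploreResult, dif_pos h]
      set e := h.choose with he_def
      have he : e ∈ U := (mem_frontier.mp h.choose_spec).1
      simp only [DTree.run]
      rw [ih _ (Finset.erase_ssubset he)]
      set K' := if ω e then G.addEnds K e else K with hK'
      have hx := exploreResult_fst_subset (G := G) ω (U.erase e) K'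
      have hU : (↑(U \ (G.exploreResult (U.erase e) K' ω).1) : Set E) =
          {e} ∪ ↑((U.erase e) \ (G.exploreResult (U.erase e) K' ω).1) := by
        ext x
        simp only [Finset.coe_sdiff, Set.mem_sdiff, Finset.mem_coe, Set.mem_union,
          Set.mem_singleton_iff, Finset.coe_erase]
        constructor
        · rintro ⟨hxU, hxR⟩
          by_cases hxe : x = e
          · exact Or.inl hxe
          · exact Or.inr ⟨⟨hxU, hxe⟩, hxR⟩
        · rintro (hxe | ⟨⟨hxU, _⟩, hxR⟩)
          · rw [hxe]
            exact ⟨he, fun hmem => (Finset.notMem_erase e U) (hx hmem)⟩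
          · exact ⟨hxU, hxR⟩
      cases toS
      · simp
      · rw [hU]
        simp only [if_true, Set.union_assoc]
    · rw [exploreThen, dif_neg h, exploreResult, dif_neg h]
      simp

/-- The configuration `ω` with every edge outside `U` closed. -/
def onEdges (U : Finset E) (ω : Config E) : Config E := fun e => ω e && decide (e ∈ U)

omit [DecidableEq V] in
/-- An edge open in the restriction is open and lies in `U`. -/
theorem onEdges_eq_true_iff {U : Finset E} {ω : Config E} {e : E} :
    onEdges U ω e = true ↔ ω e = true ∧ e ∈ U := by
  simp only [onEdges, Bool.and_eq_true, decide_eq_true_eq]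

omit [DecidableEq V] in
/-- Restricting to a smaller edge set gives a smaller configuration. -/
theorem onEdges_mono {U U' : Finset E} (h : U' ⊆ U) (ω : Config E) :
    onEdges U' ω ≤ onEdges U ω := by
  rw [Config.le_iff]
  intro e he
  rw [onEdges_eq_true_iff] at he ⊢
  exact ⟨he.1, h he.2⟩

/-- **What an exploration stage computes.**  With `(U', K') = exploreResult U K ω`: `K ⊆ K'`,
every vertex of `K'` is joined to `K` inside the unqueried edges, no `ω`-open unqueried edge
leaves `K'`, and `U'` is the set of unqueried edges not touching `K'`. -/
theorem exploreResult_spec (ω : Config E) : ∀ (U : Finset E) (K : Finset V),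
    K ⊆ (G.exploreResult U K ω).2 ∧
    (∀ x ∈ (G.exploreResult U K ω).2, ∃ k ∈ K, G.Conn (onEdges U ω) k x) ∧
    (∀ e ∈ U, ω e = true →
      (G.fst e ∈ (G.exploreResult U K ω).2 ↔ G.snd e ∈ (G.exploreResult U K ω).2)) ∧
    (G.exploreResult U K ω).1 = U.filter fun e =>
      G.fst e ∉ (G.exploreResult U K ω).2 ∧ G.snd e ∉ (G.exploreResult U K ω).2 := by
  intro U
  induction U using Finset.strongInduction with
  | H U ih =>
    intro K
    by_cases h : (G.frontier U K).Nonempty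
    · rw [exploreResult, dif_pos h]
      set e := h.choose with he_def
      have he : e ∈ U ∧ (G.fst e ∈ K ∨ G.snd e ∈ K) := mem_frontier.mp h.choose_spec
      set K₁ := if ω e then G.addEnds K e else K with hK₁
      obtain ⟨ha, hb, hc, hd⟩ := ih _ (Finset.erase_ssubset he.1) K₁
      have hKK₁ : K ⊆ K₁ := by
        rw [hK₁]; split_ifs
        · exact fun x hx => Finset.mem_insert_of_mem (Finset.mem_insert_of_mem hx)
        · exact Finset.Subset.refl _
      refine ⟨hKK₁.trans ha, ?_, ?_, ?_⟩
      · intro x hx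
        obtain ⟨k₁, hk₁, hconn⟩ := hb x hx
        have hconn' : G.Conn (onEdges U ω) k₁ x :=
          hconn.mono (onEdges_mono (Finset.erase_subset e U) ω)
        rw [hK₁] at hk₁
        split_ifs at hk₁ with hωe
        · -- `e` is open: its endpoints are adjacent to the vertex of `K` it touches
          have hopen : onEdges U ω e = true := onEdges_eq_true_iff.mpr ⟨hωe, he.1⟩
          simp only [addEnds, Finset.mem_insert] at hk₁
          have hfs : G.Conn (onEdges U ω) (G.fst e) (G.snd e) :=
            Conn.of_openAdj (G.openAdj_of_open e hopen)
          rcases he.2 with hf | hs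
          · rcases hk₁ with rfl | rfl | hk
            · exact ⟨_, hf, hconn'⟩
            · exact ⟨_, hf, hfs.trans hconn'⟩
            · exact ⟨k₁, hk, hconn'⟩
          · rcases hk₁ with rfl | rfl | hk
            · exact ⟨_, hs, hfs.symm.trans hconn'⟩
            · exact ⟨_, hs, hconn'⟩
            · exact ⟨k₁, hk, hconn'⟩
        · exact ⟨k₁, hk₁, hconn'⟩
      · intro e' he' hω
        by_cases hee : e' = e
        · rw [hee] at hω ⊢
          have hK₁' : K₁ = G.addEnds K e := by rw [hK₁, if_pos hω]
          have h1 : G.fst e ∈ K₁ := by rw [hK₁']; exact Finset.mem_insert_self _ _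
          have h2 : G.snd e ∈ K₁ := by
            rw [hK₁']; exact Finset.mem_insert_of_mem (Finset.mem_insert_self _ _)
          exact ⟨fun _ => ha h2, fun _ => ha h1⟩
        · exact hc e' (Finset.mem_erase.mpr ⟨hee, he'⟩) hω
      · rw [hd]
        ext x
        simp only [Finset.mem_filter, Finset.mem_erase]
        constructor
        · rintro ⟨⟨_, hxU⟩, hx⟩; exact ⟨hxU, hx⟩
        · rintro ⟨hxU, hx⟩
          refine ⟨⟨fun hxe => ?_, hxU⟩, hx⟩
          subst hxe
          rcases he.2 with hf | hs
          · exact hx.1 (ha (hKK₁ hf))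
          · exact hx.2 (ha (hKK₁ hs))
    · rw [exploreResult, dif_neg h]
      have hno : ∀ e ∈ U, G.fst e ∉ K ∧ G.snd e ∉ K := by
        intro e heU
        by_contra hcon
        apply h
        refine ⟨e, mem_frontier.mpr ⟨heU, ?_⟩⟩
        tauto
      refine ⟨Finset.Subset.refl _, fun x hx => ⟨x, hx, Conn.refl G _ x⟩, ?_, ?_⟩
      · intro e heU _
        have := hno e heU
        simp [this.1, this.2]
      · ext x
        simp only [Finset.mem_filter]
        exact ⟨fun hx => ⟨hx, hno x hx⟩, fun hx => hx.1⟩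

/-- The final known set of a stage is the cluster of `K` in the unqueried edges. -/
theorem coe_exploreResult_snd (ω : Config E) (U : Finset E) (K : Finset V) :
    (↑(G.exploreResult U K ω).2 : Set V) = {x | ∃ k ∈ K, G.Conn (onEdges U ω) k x} := by
  obtain ⟨ha, hb, hc, _⟩ := exploreResult_spec (G := G) ω U K
  ext x
  constructor
  · intro hx
    exact hb x (Finset.mem_coe.mp hx)
  · rintro ⟨k, hk, hconn⟩
    refine mem_of_conn_of_closed_boundary (ω := onEdges U ω) (X := (↑(G.exploreResult U K ω).2 : Set V))
      ?_ (Finset.mem_coe.mpr (ha hk)) hconn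
    intro e he
    obtain ⟨hω, heU⟩ := onEdges_eq_true_iff.mp he
    simpa using hc e heU hω

omit [DecidableEq V] in
/-- The cluster of `a` survives restriction to an edge set containing all its open edges. -/
theorem cluster_onEdges_eq {ω : Config E} {a : V} {U : Finset E}
    (hU : ∀ e, ω e = true → e ∈ G.edgesAt (G.cluster ω a) → e ∈ U) :
    G.cluster (onEdges U ω) a = G.cluster ω a := by
  ext x
  constructor
  · intro hx
    exact Conn.mono (fun e he => (onEdges_eq_true_iff.mp he).1) hx
  · intro hx
    exact conn_of_open_edges (fun e he hmem => onEdges_eq_true_iff.mpr ⟨he, hU e he hmem⟩) hx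

/-- The cluster of `a` is untouched by the edges at a disjoint vertex set. -/
theorem cluster_onEdges_filter_eq {ω : Config E} {a : V} {U : Finset E} (X : Finset V)
    (hU : ∀ e, ω e = true → e ∈ G.edgesAt (G.cluster ω a) → e ∈ U)
    (hX : ∀ x ∈ G.cluster ω a, x ∉ X) :
    G.cluster (onEdges (U.filter fun e => G.fst e ∉ X ∧ G.snd e ∉ X) ω) a = G.cluster ω a := by
  apply cluster_onEdges_eq
  intro e he hmem
  refine Finset.mem_filter.mpr ⟨hU e he hmem, ?_⟩
  have hboth : G.fst e ∈ G.cluster ω a ∧ G.snd e ∈ G.cluster ω a := by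
    rcases hmem with h | h
    · exact ⟨h, G.snd_mem_cluster_of_open he h⟩
    · exact ⟨G.fst_mem_cluster_of_open he h, h⟩
  exact ⟨hX _ hboth.1, hX _ hboth.2⟩

omit [DecidableEq V] in
/-- Restricting to all edges changes nothing. -/
theorem onEdges_univ [Fintype E] (ω : Config E) : onEdges Finset.univ ω = ω := by
  funext e
  simp [onEdges]

/-- A chain is proper as soon as the unqueried edges avoid the queried set and every
continuation is proper on its own unqueried edges. -/
theorem proper_exploreThen (toS : Bool) (cont : Finset E → DTree E)
    (hcont : ∀ (U' : Finset E) (Q' : Set E), (∀ e ∈ U', e ∉ Q') → DTree.Proper (cont U') Q') :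
    ∀ (U : Finset E) (K : Finset V) (Q : Set E), (∀ e ∈ U, e ∉ Q) →
      DTree.Proper (G.exploreThen toS U K cont) Q := by
  intro U
  induction U using Finset.strongInduction with
  | H U ih =>
    intro K Q hQ
    by_cases h : (G.frontier U K).Nonempty
    · rw [exploreThen, dif_pos h]
      have he : h.choose ∈ U := (mem_frontier.mp h.choose_spec).1
      refine ⟨hQ _ he, fun b b' => ih _ (Finset.erase_ssubset he) _ _ ?_⟩
      intro e' he' hmem
      rcases Set.mem_insert_iff.mp hmem with h' | hmem'
      · rw [h'] at he'
        exact Finset.notMem_erase _ U he'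
      · exact hQ e' (Finset.mem_of_mem_erase he') hmem'
    · rw [exploreThen, dif_neg h]
      exact hcont U Q hQ

end MultiGraph

end PercRepro
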